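import Summits.Parity.GeneralizedHardyLittlewood.Theses.GreenTaoLevelTwo
import Summits.Parity.GeneralizedHardyLittlewood.Theorems.GreenTaoLevelTwoGITwoCyclicToIntervalPrelims
import Summits.Parity.GeneralizedHardyLittlewood.Theorems.GreenTaoLevelTwoGITwoCyclicToIntervalCutoff
import HarnessLib

/-!
# Route `GreenTaoLevelTwo`, crux `GITwo` (stmt-Parity-21275), line `birth`: the transfer stub
# `stub_cyclicToInterval` — from the `U³(ℤ/N'ℤ)` inverse theorem to the `U³[N]` inverse datum

The registered glue stub of the `GITwo` birth skeleton, BY NAME with its signature spelled out: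
the `U³(ℤ/N'ℤ)` inverse theorem over the Heisenberg class (Green–Tao 2008a Thm. 12.8, the XL stub
`stub_cyclicInverse`, taken here as the HYPOTHESIS — this file is the implication, not a proof of
the inverse theorem) implies `GITwo` (`GI(2)` on `[N]`, GT2010 Prop. 8.4, for every box-comparable
Def-8.1 metric).  Proof (GT2010 App. B / §8, "the choice of `[N]` versus `ℤ/N'ℤ` is immaterial"):

1. `η = δ/5`; get the finite family `𝓜ᵢ`, `M`, `c` from the hypothesis; the answer is the family
   `𝓜ᵢ × ℝ/ℤ` (still in the Heisenberg class), `M_G = max(M,0) + 8/c`, `c_G = c/2`.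
2. Given `N ≥ 1` and a `1`-bounded `f` with `‖f‖_{U³[N]} ≥ δ`: a prime `N' ∈ (2N, 4N]`
   (`exists_prime_two_mul_lt_le_four_mul`), `‖f1_{[N]}‖⁸_{U³(ℤ/N')} ≥ (δ/5)⁸`
   (`gowersPower_extendByZero_ge`), so some `F(gⁿx₀)` on some `𝓜ᵢ` correlates `≥ c` with the
   shifted extension over the representatives `[−(N'−1)/2, (N'−1)/2]`.
3. Re-index onto `m ∈ [N]` (`sum_extendByZero_shift_mul_eq`), split at the wrap-around threshold
   into two INTERVAL orbit sums from shifted base points (`sum_ite_threshold_eq`,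
   `zpow`-bookkeeping); one of them is `≥ cN'/2` in size (`half_le_abs_or_of_le_abs_add`).
4. Read that interval piece over all of `[N]` against the cutoff nilsequence `ψ(m/N')` on `ℝ/ℤ`
   (`cutoff_*`, error `≤ 2N'/K = cN'/4` with `K = 8/c`), i.e. against the tensor `F ⊗ ψ` on
   `𝓜ᵢ × ℝ/ℤ` (`isBoundedLipschitz_tensor`, `tensor_orbit`): correlation `≥ cN'/4 ≥ cN/2`.

References: B. Green, T. Tao, *Linear equations in primes*, Ann. of Math. 171 (2010), Prop. 8.4,
App. B Lemma B.5 [GreenTao2010]; B. Green, T. Tao, *An inverse theorem for the Gowers U³(G) norm*,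
Proc. Edinb. Math. Soc. 51 (2008), Thm. 12.8 and §12 [GreenTao2008U3Inverse].
-/

noncomputable section

open Literature.NumberTheory.Sieve
open Literature.NumberTheory.Sieve.GreenTaoLevelTwo (HX IsCompatMetric IsBoxComparable heisenbergWith
  InHeisClass)

namespace Summit.Parity.GeneralizedHardyLittlewood.GreenTaoLevelTwoGITwoCyclicToInterval

/-! ### §1 Bookkeeping: shifted base points, `ℕ`- versus `ℤ`-indexed orbit sums, the rotation -/

/-- `g^{m+e} x₀ = gᵐ · (gᵉ out(x₀))Γ` for `m ≥ 0` (read `m` in `ℕ`). [folklore] -/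
theorem toNat_smul_mk_eq {s : ℕ} (X : Nilmanifold s) (g : X.G) (x₀ : X.G ⧸ X.Γ) {m : ℤ} (e : ℤ)
    (hm : 0 ≤ m) :
    g ^ m.toNat • (QuotientGroup.mk (g ^ e * Quotient.out x₀) : X.G ⧸ X.Γ) = g ^ (m + e) • x₀ := by
  calc g ^ m.toNat • (QuotientGroup.mk (g ^ e * Quotient.out x₀) : X.G ⧸ X.Γ)
      = g ^ m.toNat • (g ^ e • (QuotientGroup.mk (Quotient.out x₀) : X.G ⧸ X.Γ)) := rfl
    _ = (g ^ m.toNat * g ^ e) • (QuotientGroup.mk (Quotient.out x₀) : X.G ⧸ X.Γ) :=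
        (mul_smul _ _ _).symm
    _ = g ^ (m + e) • x₀ := by
        rw [QuotientGroup.out_eq', ← zpow_natCast, Int.toNat_of_nonneg hm, ← zpow_add]

/-- `ℕ`-indexed orbit sums over `[N]` are `ℤ`-indexed ones (exponent read through `toNat`).
[folklore] -/
theorem sum_Icc_nat_eq_sum_Icc_int (N : ℕ) (G : ℤ → ℝ) :
    ∑ n ∈ Finset.Icc 1 N, G n = ∑ m ∈ Finset.Icc (1 : ℤ) N, G m := by
  refine Finset.sum_bij' (fun n _ => (n : ℤ)) (fun m _ => m.toNat) ?_ ?_ ?_ ?_ ?_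
  · intro n hn
    obtain ⟨h1, h2⟩ := Finset.mem_Icc.mp hn
    exact Finset.mem_Icc.mpr ⟨by exact_mod_cast h1, by exact_mod_cast h2⟩
  · intro m hm
    obtain ⟨h1, h2⟩ := Finset.mem_Icc.mp hm
    refine Finset.mem_Icc.mpr ⟨?_, ?_⟩ <;> omega
  · intro n _; simp
  · intro m hm
    obtain ⟨h1, _⟩ := Finset.mem_Icc.mp hm
    exact Int.toNat_of_nonneg (by omega)
  · intro n _; simp

/-- The rotation orbit on the circle factor: `(1/N')ⁿ · 0 + ℤ = n/N' + ℤ`. [folklore] -/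
theorem rotation_orbit (N' n : ℕ) :
    (QuotientGroup.mk (Multiplicative.ofAdd (1 / (N' : ℝ)) ^ n * Multiplicative.ofAdd (0 : ℝ)) :
        Nilmanifold.circle.G ⧸ Nilmanifold.circle.Γ) = circlePt ((n : ℝ) / N') := by
  have e : Multiplicative.ofAdd (1 / (N' : ℝ)) ^ n * Multiplicative.ofAdd (0 : ℝ) =
      Multiplicative.ofAdd ((n : ℝ) / N') := by
    rw [← ofAdd_nsmul, ← ofAdd_add, nsmul_eq_mul]
    congr 1
    ring
  rw [e]
  rfl

/-! ### §2 An interval piece of size `c'` gives a datum on `X × ℝ/ℤ` with correlation `c'/2N` -/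

/-- **From an interval orbit sum to an orbit average on `X × ℝ/ℤ`**: if
`|∑_{m ∈ [a,b]} f(m) F(gᵐ xΓ)| ≥ c'` with `[a,b] ⊆ [N]`, `2N < N'`, `F` `1`-bounded `M`-Lipschitz,
`|f| ≤ 1`, and `2N'/K ≤ c'/2` (`K > 0`), then `F ⊗ ψ` (`ψ` the cutoff of `[a,b]` at scale `N'`,
slope `K`) is `1`-bounded `(max(M,0) + K)`-Lipschitz on `X × ℝ/ℤ` and
`|𝔼_{n ∈ [N]} f(n) (F ⊗ ψ)((g, 1/N')ⁿ (x, 0))| ≥ c'/(2N)`.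
[cite: GreenTao2010, §8 (Prop. 8.4) and App. B (Lemma B.5)] -/
theorem datum_of_interval_piece (X : Nilmanifold 2) {M K c' : ℝ} (hK : 0 < K)
    {F : X.G ⧸ X.Γ → ℝ} (hF : X.IsBoundedLipschitz M F) (g xelt : X.G) {f : ℤ → ℝ}
    (hf : ∀ n, |f n| ≤ 1) {N N' : ℕ} (hN : 1 ≤ N) (h2N : 2 * N < N') {a b : ℤ} (ha : 1 ≤ a)
    (hb : b ≤ N)
    (hpiece : c' ≤ |∑ m ∈ Finset.Icc a b,
      f m * F (g ^ m.toNat • (QuotientGroup.mk xelt : X.G ⧸ X.Γ))|)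
    (herr : 2 * N' / K ≤ c' / 2) :
    ∃ (gg : (X.prod (Nilmanifold.circle.ofLE one_le_two)).G)
      (xx : (X.prod (Nilmanifold.circle.ofLE one_le_two)).G ⧸
        (X.prod (Nilmanifold.circle.ofLE one_le_two)).Γ)
      (FF : (X.prod (Nilmanifold.circle.ofLE one_le_two)).G ⧸
        (X.prod (Nilmanifold.circle.ofLE one_le_two)).Γ → ℝ),
      (X.prod (Nilmanifold.circle.ofLE one_le_two)).IsBoundedLipschitz (max M 0 + K) FF ∧
        c' / 2 / N ≤ |(X.prod (Nilmanifold.circle.ofLE one_le_two)).orbitAverage N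
          (fun n => f n) FF gg xx| := by
  have hN'pos : (0 : ℝ) < N' := by exact_mod_cast (show 0 < N' by omega)
  have hNpos : (0 : ℝ) < N := by exact_mod_cast hN
  have hc' : 0 < c' := by
    have : 0 < 2 * (N' : ℝ) / K := by positivity
    linarith
  have hab : a ≤ b := by
    by_contra h
    push Not at h
    rw [Finset.Icc_eq_empty (not_le.mpr h), Finset.sum_empty, abs_zero] at hpiece
    linarith
  -- the cutoff `ψ` and the tensor `F ⊗ ψ`
  have hψ : (Nilmanifold.circle.ofLE one_le_two).IsBoundedLipschitz K (fun θ => max (min (1 + K * ((b - a : ℝ) / (2 * N') -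
      Nilmanifold.circle.dist θ (circlePt ((a + b : ℝ) / (2 * N'))))) 1) 0) :=
    (Nilmanifold.isBoundedLipschitz_ofLE _ _ K _).mpr (cutoff_isBoundedLipschitz hK.le _ _)
  have hFmax : X.IsBoundedLipschitz (max M 0) F :=
    ⟨hF.1, fun y z => (hF.2 y z).trans
      (mul_le_mul_of_nonneg_right (le_max_left _ _) (X.dist_nonneg _ _))⟩
  have hFF := isBoundedLipschitz_tensor X (Nilmanifold.circle.ofLE one_le_two) (le_max_right M 0) hK.le hFmax hψ
  refine ⟨((g, (Multiplicative.ofAdd (1 / (N' : ℝ)) : Multiplicative ℝ)) : X.G × (Nilmanifold.circle.ofLE one_le_two).G),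
    (QuotientGroup.mk (xelt, (Multiplicative.ofAdd (0 : ℝ) : Multiplicative ℝ)) : (X.G × (Nilmanifold.circle.ofLE one_le_two).G) ⧸ X.Γ.prod (Nilmanifold.circle.ofLE one_le_two).Γ), _, hFF, ?_⟩
  -- the orbit, `ℕ`-indexed, read through the two factors
  have horb : ∀ n : ℕ,
      F (Nilmanifold.quotientProdMap X (Nilmanifold.circle.ofLE one_le_two)
          (((g, (Multiplicative.ofAdd (1 / (N' : ℝ)) : Multiplicative ℝ)) :
              X.G × (Nilmanifold.circle.ofLE one_le_two).G) ^ n •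
            (QuotientGroup.mk (xelt, (Multiplicative.ofAdd (0 : ℝ) : Multiplicative ℝ)) :
              (X.G × (Nilmanifold.circle.ofLE one_le_two).G) ⧸
                X.Γ.prod (Nilmanifold.circle.ofLE one_le_two).Γ))).1 *
        max (min (1 + K * ((b - a : ℝ) / (2 * N') -
          Nilmanifold.circle.dist
            (Nilmanifold.quotientProdMap X (Nilmanifold.circle.ofLE one_le_two)
              (((g, (Multiplicative.ofAdd (1 / (N' : ℝ)) : Multiplicative ℝ)) :
                  X.G × (Nilmanifold.circle.ofLE one_le_two).G) ^ n •
                (QuotientGroup.mk (xelt, (Multiplicative.ofAdd (0 : ℝ) : Multiplicative ℝ)) :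
                  (X.G × (Nilmanifold.circle.ofLE one_le_two).G) ⧸
                    X.Γ.prod (Nilmanifold.circle.ofLE one_le_two).Γ))).2
            (circlePt ((a + b : ℝ) / (2 * N'))))) 1) 0 =
      F (g ^ n • (QuotientGroup.mk xelt : X.G ⧸ X.Γ)) *
        max (min (1 + K * ((b - a : ℝ) / (2 * N') -
          Nilmanifold.circle.dist (circlePt ((n : ℝ) / N'))
            (circlePt ((a + b : ℝ) / (2 * N'))))) 1) 0 := by
    intro n
    have h := tensor_orbit X (Nilmanifold.circle.ofLE one_le_two) F
      (fun θ => max (min (1 + K * ((b - a : ℝ) / (2 * N') -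
        Nilmanifold.circle.dist θ (circlePt ((a + b : ℝ) / (2 * N'))))) 1) 0)
      g xelt (Multiplicative.ofAdd (1 / (N' : ℝ)) : Multiplicative ℝ)
      (Multiplicative.ofAdd (0 : ℝ) : Multiplicative ℝ) n
    rw [← rotation_orbit N' n]
    exact h
  -- the orbit average as a `ℤ`-indexed sum over `[N]`
  have hsumZ : ∑ n ∈ Finset.Icc 1 N, f (n : ℤ) *
      (F (Nilmanifold.quotientProdMap X (Nilmanifold.circle.ofLE one_le_two)
          (((g, (Multiplicative.ofAdd (1 / (N' : ℝ)) : Multiplicative ℝ)) :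
              X.G × (Nilmanifold.circle.ofLE one_le_two).G) ^ n •
            (QuotientGroup.mk (xelt, (Multiplicative.ofAdd (0 : ℝ) : Multiplicative ℝ)) :
              (X.G × (Nilmanifold.circle.ofLE one_le_two).G) ⧸
                X.Γ.prod (Nilmanifold.circle.ofLE one_le_two).Γ))).1 *
        max (min (1 + K * ((b - a : ℝ) / (2 * N') -
          Nilmanifold.circle.dist
            (Nilmanifold.quotientProdMap X (Nilmanifold.circle.ofLE one_le_two)
              (((g, (Multiplicative.ofAdd (1 / (N' : ℝ)) : Multiplicative ℝ)) :
                  X.G × (Nilmanifold.circle.ofLE one_le_two).G) ^ n •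
                (QuotientGroup.mk (xelt, (Multiplicative.ofAdd (0 : ℝ) : Multiplicative ℝ)) :
                  (X.G × (Nilmanifold.circle.ofLE one_le_two).G) ⧸
                    X.Γ.prod (Nilmanifold.circle.ofLE one_le_two).Γ))).2
            (circlePt ((a + b : ℝ) / (2 * N'))))) 1) 0) =
      ∑ m ∈ Finset.Icc (1 : ℤ) N, f m * F (g ^ m.toNat • (QuotientGroup.mk xelt : X.G ⧸ X.Γ)) *
        max (min (1 + K * ((b - a : ℝ) / (2 * N') -
          Nilmanifold.circle.dist (circlePt ((m : ℝ) / N'))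
            (circlePt ((a + b : ℝ) / (2 * N'))))) 1) 0 := by
    calc _ = ∑ n ∈ Finset.Icc 1 N, f (n : ℤ) * F (g ^ (n : ℤ).toNat •
          (QuotientGroup.mk xelt : X.G ⧸ X.Γ)) *
          max (min (1 + K * ((b - a : ℝ) / (2 * N') -
            Nilmanifold.circle.dist (circlePt (((n : ℤ) : ℝ) / (N' : ℝ)))
              (circlePt ((a + b : ℝ) / (2 * N'))))) 1) 0 := by
          refine Finset.sum_congr rfl fun n _ => ?_
          rw [horb n, Int.toNat_natCast, Int.cast_natCast, mul_assoc]
      _ = _ := sum_Icc_nat_eq_sum_Icc_int N (fun m => f m * F (g ^ m.toNat •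
          (QuotientGroup.mk xelt : X.G ⧸ X.Γ)) *
          max (min (1 + K * ((b - a : ℝ) / (2 * N') -
            Nilmanifold.circle.dist (circlePt ((m : ℝ) / N'))
              (circlePt ((a + b : ℝ) / (2 * N'))))) 1) 0)
  have havg : (X.prod (Nilmanifold.circle.ofLE one_le_two)).orbitAverage N (fun n => f n)
      (fun q => F (Nilmanifold.quotientProdMap X (Nilmanifold.circle.ofLE one_le_two) q).1 *
          (fun θ => max (min (1 + K * ((b - a : ℝ) / (2 * N') -
            Nilmanifold.circle.dist θ (circlePt ((a + b : ℝ) / (2 * N'))))) 1) 0)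
            (Nilmanifold.quotientProdMap X (Nilmanifold.circle.ofLE one_le_two) q).2)
      ((g, (Multiplicative.ofAdd (1 / (N' : ℝ)) : Multiplicative ℝ)) :
        X.G × (Nilmanifold.circle.ofLE one_le_two).G)
      (QuotientGroup.mk (xelt, (Multiplicative.ofAdd (0 : ℝ) : Multiplicative ℝ)) :
        (X.G × (Nilmanifold.circle.ofLE one_le_two).G) ⧸
          X.Γ.prod (Nilmanifold.circle.ofLE one_le_two).Γ) =
      (∑ m ∈ Finset.Icc (1 : ℤ) N, f m * F (g ^ m.toNat • (QuotientGroup.mk xelt : X.G ⧸ X.Γ)) *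
        max (min (1 + K * ((b - a : ℝ) / (2 * N') -
          Nilmanifold.circle.dist (circlePt ((m : ℝ) / N'))
            (circlePt ((a + b : ℝ) / (2 * N'))))) 1) 0) / N := by
    rw [← hsumZ]
    rfl
  rw [havg, abs_div, Nat.abs_cast, div_le_div_iff_of_pos_right hNpos]
  -- replace the cutoff by the indicator of `[a, b]` at cost `≤ 2N'/K ≤ c'/2`
  have hcut : |∑ m ∈ Finset.Icc (1 : ℤ) N,
        f m * F (g ^ m.toNat • (QuotientGroup.mk xelt : X.G ⧸ X.Γ)) *
          max (min (1 + K * ((b - a : ℝ) / (2 * N') -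
            Nilmanifold.circle.dist (circlePt ((m : ℝ) / N'))
              (circlePt ((a + b : ℝ) / (2 * N'))))) 1) 0 -
      ∑ m ∈ Finset.Icc (1 : ℤ) N,
        f m * F (g ^ m.toNat • (QuotientGroup.mk xelt : X.G ⧸ X.Γ)) *
          (if a ≤ m ∧ m ≤ b then 1 else 0)| ≤ 2 * N' / K :=
    abs_sum_mul_sub_sum_indicator_le (N := N) (N' := N') (a := a) (b := b) (by omega) hK
      (fun m => f m * F (g ^ m.toNat • (QuotientGroup.mk xelt : X.G ⧸ X.Γ)))
      (fun m => max (min (1 + K * ((b - a : ℝ) / (2 * N') -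
        Nilmanifold.circle.dist (circlePt ((m : ℝ) / N')) (circlePt ((a + b : ℝ) / (2 * N'))))) 1) 0)
      (fun m => by
        rw [abs_mul]
        calc |f m| * |F _| ≤ 1 * 1 := mul_le_mul (hf m) (hF.1 _) (abs_nonneg _) zero_le_one
          _ = 1 := one_mul 1)
      (fun m => cutoff_mem_unitInterval K _ _ _)
      (fun m ham hmb => cutoff_eq_one h2N ha hb ham hmb hK.le)
      (fun m hm1 hmN hfar => cutoff_eq_zero h2N ha hab hb hm1 hmN hK hfar)
  have hind : ∑ m ∈ Finset.Icc a b, f m * F (g ^ m.toNat • (QuotientGroup.mk xelt : X.G ⧸ X.Γ)) =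
      ∑ m ∈ Finset.Icc (1 : ℤ) N, f m * F (g ^ m.toNat • (QuotientGroup.mk xelt : X.G ⧸ X.Γ)) *
        (if a ≤ m ∧ m ≤ b then 1 else 0) := by
    rw [sum_Icc_eq_sum_indicator ha hb f
      (fun m => F (g ^ m.toNat • (QuotientGroup.mk xelt : X.G ⧸ X.Γ)))]
    exact Finset.sum_congr rfl fun m _ => by ring
  rw [hind] at hpiece
  have key := abs_sub_abs_le_abs_sub
    (∑ m ∈ Finset.Icc (1 : ℤ) N, f m * F (g ^ m.toNat • (QuotientGroup.mk xelt : X.G ⧸ X.Γ)) *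
        (if a ≤ m ∧ m ≤ b then 1 else 0))
    (∑ m ∈ Finset.Icc (1 : ℤ) N, f m * F (g ^ m.toNat • (QuotientGroup.mk xelt : X.G ⧸ X.Γ)) *
        max (min (1 + K * ((b - a : ℝ) / (2 * N') -
          Nilmanifold.circle.dist (circlePt ((m : ℝ) / N'))
            (circlePt ((a + b : ℝ) / (2 * N'))))) 1) 0)
  have key2 := le_abs_self
    (|∑ m ∈ Finset.Icc (1 : ℤ) N, f m * F (g ^ m.toNat • (QuotientGroup.mk xelt : X.G ⧸ X.Γ)) *
        (if a ≤ m ∧ m ≤ b then 1 else 0)| -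
     |∑ m ∈ Finset.Icc (1 : ℤ) N, f m * F (g ^ m.toNat • (QuotientGroup.mk xelt : X.G ⧸ X.Γ)) *
        max (min (1 + K * ((b - a : ℝ) / (2 * N') -
          Nilmanifold.circle.dist (circlePt ((m : ℝ) / N'))
            (circlePt ((a + b : ℝ) / (2 * N'))))) 1) 0|)
  rw [abs_sub_comm
    (∑ m ∈ Finset.Icc (1 : ℤ) N, f m * F (g ^ m.toNat • (QuotientGroup.mk xelt : X.G ⧸ X.Γ)) *
        (if a ≤ m ∧ m ≤ b then 1 else 0))] at key
  linarith

/-! ### §3 The stub -/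

/-- **`stub_cyclicToInterval` (registered glue stub of the `GITwo` skeleton, BY NAME, signature
spelled out)**: the `U³(ℤ/N'ℤ)` inverse theorem over the Heisenberg class of `H_d` (`N'` an odd
prime, correlation over the representatives `[−(N'−1)/2, (N'−1)/2]`, shift `h`) implies the route
crux `GITwo` — `GI(2)` on `[N]` with inverse families in the Heisenberg class, for every compatible
box-comparable metric `d`: family `𝓜ᵢ × ℝ/ℤ`, `M_G = max(M, 0) + 8/c`, `c_G = c/2`, `η = δ/5`.
[cite: GreenTao2010, Prop. 8.4 and App. B, Lemma B.5] [cite: GreenTao2008U3Inverse, Thm. 12.8] -/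
theorem stub_cyclicToInterval :
    (∀ (d : HX → HX → ℝ) (h : IsCompatMetric d), IsBoxComparable d →
      ∀ η : ℝ, 0 < η → η ≤ 1 → ∃ (m : ℕ) (𝓜 : Fin m → Nilmanifold 2) (M c : ℝ),
        (∀ i, InHeisClass (heisenbergWith d h) (𝓜 i)) ∧ 0 < c ∧
          ∀ (N' : ℕ) [NeZero N'], N'.Prime → 2 < N' → ∀ f : ZMod N' → ℝ, (∀ x, |f x| ≤ 1) →
            η ^ 8 ≤ gowersPower 3 f →
              ∃ (i : Fin m) (g : (𝓜 i).G) (x₀ : (𝓜 i).G ⧸ (𝓜 i).Γ) (hsh : ZMod N')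
                (F : (𝓜 i).G ⧸ (𝓜 i).Γ → ℝ),
                (𝓜 i).IsBoundedLipschitz M F ∧
                  c ≤ |(∑ n ∈ Finset.Icc (-((N' : ℤ) / 2)) ((N' : ℤ) / 2),
                      f ((n : ZMod N') + hsh) * F (g ^ n • x₀)) / N'|) →
      Summit.Parity.GeneralizedHardyLittlewood.Theses.GreenTaoLevelTwo.GITwo := by
  intro hCI d h hbox δ hδ hδ1
  obtain ⟨m, 𝓜, M, c, hcls, hc, hmain⟩ := hCI d h hbox (δ / 5) (by positivity) (by linarith)
  refine ⟨m, fun i => (𝓜 i).prod (Nilmanifold.circle.ofLE one_le_two),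
    max M 0 + 8 / c, c / 2, fun i => InHeisClass.prod (hcls i) InHeisClass.circle, ?_⟩
  refine ⟨by positivity, ?_⟩
  intro N hN f hf hδf
  have hNpos : (0 : ℝ) < N := by exact_mod_cast hN
  -- the auxiliary prime and the cyclic norm
  obtain ⟨N', hN'p, h2N, h4N, h2⟩ := exists_prime_two_mul_lt_le_four_mul hN
  haveI : NeZero N' := ⟨by omega⟩
  have hN'pos : (0 : ℝ) < N' := by exact_mod_cast (show 0 < N' by omega)
  have hgp : (δ / 5) ^ 8 ≤ gowersPower 3 (extendByZero N' N f) :=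
    gowersPower_extendByZero_ge hN (by omega) h4N hδ.le f hδf
  have hf1 : ∀ x, |extendByZero N' N f x| ≤ 1 := by
    intro x
    unfold extendByZero
    split_ifs
    · exact hf _
    · simp
  obtain ⟨i, g, x₀, hsh, F, hF, hcorr⟩ := hmain N' hN'p h2 (extendByZero N' N f) hf1 hgp
  -- re-index onto `[N]` and split at the wrap-around threshold
  have hodd : N' % 2 = 1 := Nat.odd_iff.mp (hN'p.odd_of_ne_two (by omega))
  rw [sum_extendByZero_shift_mul_eq h2N hodd f (fun n => F (g ^ n • x₀)) hsh,
    sum_ite_threshold_eq N ((N' : ℤ) / 2) (hsh.val : ℤ) (N' : ℤ) f (fun n => F (g ^ n • x₀)),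
    abs_div, Nat.abs_cast, le_div_iff₀ hN'pos] at hcorr
  -- the two pieces as `ℕ`-exponent orbit sums from shifted base points
  have hA_eq : ∑ x ∈ Finset.Icc (max 1 ((hsh.val : ℤ) - (N' : ℤ) / 2)) (N : ℤ),
      f x * F (g ^ (x - (hsh.val : ℤ)) • x₀) =
      ∑ x ∈ Finset.Icc (max 1 ((hsh.val : ℤ) - (N' : ℤ) / 2)) (N : ℤ),
        f x * F (g ^ x.toNat •
          (QuotientGroup.mk (g ^ (-(hsh.val : ℤ)) * Quotient.out x₀) : (𝓜 i).G ⧸ (𝓜 i).Γ)) := by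
    refine Finset.sum_congr rfl fun x hx => ?_
    have hx0 : 0 ≤ x := by
      have := (Finset.mem_Icc.mp hx).1; rw [max_le_iff] at this; omega
    rw [toNat_smul_mk_eq (𝓜 i) g x₀ _ hx0, ← sub_eq_add_neg]
  have hB_eq : ∑ x ∈ Finset.Icc (1 : ℤ) (min (N : ℤ) ((hsh.val : ℤ) - (N' : ℤ) / 2 - 1)),
      f x * F (g ^ (x - (hsh.val : ℤ) + (N' : ℤ)) • x₀) =
      ∑ x ∈ Finset.Icc (1 : ℤ) (min (N : ℤ) ((hsh.val : ℤ) - (N' : ℤ) / 2 - 1)),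
        f x * F (g ^ x.toNat •
          (QuotientGroup.mk (g ^ ((N' : ℤ) - (hsh.val : ℤ)) * Quotient.out x₀) :
            (𝓜 i).G ⧸ (𝓜 i).Γ)) := by
    refine Finset.sum_congr rfl fun x hx => ?_
    have hx0 : 0 ≤ x := by have := (Finset.mem_Icc.mp hx).1; omega
    rw [toNat_smul_mk_eq (𝓜 i) g x₀ _ hx0]
    congr 3
    ring
  rw [hA_eq, hB_eq] at hcorr
  have herr : 2 * (N' : ℝ) / (8 / c) ≤ c * N' / 2 / 2 := by
    rw [div_div_eq_mul_div]
    nlinarith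
  have hK : (0 : ℝ) < 8 / c := by positivity
  have hfin : c / 2 ≤ c * N' / 2 / 2 / N := by
    rw [le_div_iff₀ hNpos]
    have : 2 * (N : ℝ) < N' := by exact_mod_cast h2N
    nlinarith
  rcases half_le_abs_or_of_le_abs_add hcorr with hA | hB
  · -- the un-wrapped piece `[max(1, h₀ − (N'−1)/2), N]`
    obtain ⟨gg, xx, FF, hFF, havg⟩ := datum_of_interval_piece (𝓜 i) hK hF g
      (g ^ (-(hsh.val : ℤ)) * Quotient.out x₀) hf hN h2N (le_max_left _ _) le_rfl hA herr
    exact ⟨i, gg, xx, FF, hFF, hfin.trans havg⟩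
  · -- the wrapped piece `[1, min(N, h₀ − (N'+1)/2)]`
    obtain ⟨gg, xx, FF, hFF, havg⟩ := datum_of_interval_piece (𝓜 i) hK hF g
      (g ^ ((N' : ℤ) - (hsh.val : ℤ)) * Quotient.out x₀) hf hN h2N le_rfl (min_le_left _ _) hB herr
    exact ⟨i, gg, xx, FF, hFF, hfin.trans havg⟩

end Summit.Parity.GeneralizedHardyLittlewood.GreenTaoLevelTwoGITwoCyclicToInterval

end
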